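import Summits.Ventures.PercRepro.RankLevelSetPrimeCover

/-!
# PercRepro — lines and planes of the `e`-free core: two points span a line, (K5), the covering pair (K3′) (night-1, gen 3)

`proofs/NIGHT-1-C025-induction.md` §14.22, the line/plane lemmas of mine-4's `F4-PROOF.md` §1 in the `Set` form of
`RankLevelSetPrimeCover` (`GClosed M G H` = `H ⊆ G` and `cl(H) ∩ G ⊆ H`, coloops allowed):

* **`gclosed_subset_of_two_le_inter`** / **`gclosed_eq_of_two_le_inter`** — two points span a line: a `G`-closed set
  of rank `≤ 2` meeting a `G`-closed set in `≥ 2` points lies in it (equal when both have rank `≤ 2`);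
* **`gclosed_subset_of_line_of_mem`** (K5) — planes through a line: a `G`-closed set of rank `≤ 3` containing a
  `G`-closed line `ℓ` (`≥ 2` points) lies in every `G`-closed set `⊇ ℓ` sharing with it a point off `ℓ`;
* **`cover_pair_eq`** (K3′) — a `5`-point set `H` covered by a `3`-point `G`-closed line `ℓ₁ ⊆ H` and a `G`-closed
  line `ℓ₂ ⊇ H ∖ ℓ₁` has no other cover by two `G`-closed lines: every such pair is `(ℓ₁, ℓ₂)` or `(ℓ₂, ℓ₁)`
  (pigeonhole on `ℓ₁`, then two points span a line, twice).
Used by `RankLevelSetPlaneTen` (`f(4) ≤ 10`). Axioms: standard.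
-/

open scoped Matroid

namespace PercRepro

namespace ThmN

variable {α : Type}

/-- Two points span a line: a `G`-closed set `A` of rank `≤ 2` meeting a `G`-closed set `B` in `≥ 2` points lies
in `B`. -/
theorem gclosed_subset_of_two_le_inter (M : Matroid α) [M.Finite]
    (hfree : ∀ e ∈ M.E, ∃ A ⊆ M.E \ {e}, e ∉ M.closure A ∧ e ∉ M.closure ((M.E \ {e}) \ A))
    {G A B : Set α} (hG : G ⊆ M.E) (hA : GClosed M G A) (hB : GClosed M G B) (hrA : M.eRk A ≤ 2)
    (h2 : 2 ≤ (A ∩ B).ncard) : A ⊆ B := by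
  have hAfin : A.Finite := (M.ground_finite.subset hG).subset hA.1
  have hrAB : (2 : ℕ∞) ≤ M.eRk (A ∩ B) :=
    two_le_eRk_of_two_le_ncard_of_free M hfree (Set.inter_subset_left.trans (hA.1.trans hG)) h2
  have hcl : A ⊆ M.closure (A ∩ B) :=
    subset_closure_of_eRk_le M Set.inter_subset_left (hA.1.trans hG) hAfin (hrA.trans hrAB)
  intro y hy
  exact hB.2 ⟨M.closure_subset_closure Set.inter_subset_right (hcl hy), hA.1 hy⟩

/-- Two `G`-closed sets of rank `≤ 2` sharing `≥ 2` points are equal. -/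
theorem gclosed_eq_of_two_le_inter (M : Matroid α) [M.Finite]
    (hfree : ∀ e ∈ M.E, ∃ A ⊆ M.E \ {e}, e ∉ M.closure A ∧ e ∉ M.closure ((M.E \ {e}) \ A))
    {G A B : Set α} (hG : G ⊆ M.E) (hA : GClosed M G A) (hB : GClosed M G B) (hrA : M.eRk A ≤ 2)
    (hrB : M.eRk B ≤ 2) (h2 : 2 ≤ (A ∩ B).ncard) : A = B :=
  Set.Subset.antisymm (gclosed_subset_of_two_le_inter M hfree hG hA hB hrA h2)
    (gclosed_subset_of_two_le_inter M hfree hG hB hA hrB (by rwa [Set.inter_comm]))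

/-- **(K5) planes through a line**: a `G`-closed set `G₁` of rank `≤ 3` containing a `G`-closed line `ℓ` (`≥ 2`
points) lies in every `G`-closed set `G₂ ⊇ ℓ` that shares with it a point `z ∉ ℓ`. -/
theorem gclosed_subset_of_line_of_mem (M : Matroid α) [M.Finite]
    (hfree : ∀ e ∈ M.E, ∃ A ⊆ M.E \ {e}, e ∉ M.closure A ∧ e ∉ M.closure ((M.E \ {e}) \ A))
    {G ℓ G₁ G₂ : Set α} (hG : G ⊆ M.E) (hℓ : GClosed M G ℓ) (h2 : 2 ≤ ℓ.ncard) (hG₁ : GClosed M G G₁)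
    (hG₂ : GClosed M G G₂) (hr₁ : M.eRk G₁ ≤ 3) (hℓ₁ : ℓ ⊆ G₁) (hℓ₂ : ℓ ⊆ G₂) {z : α} (hz₁ : z ∈ G₁)
    (hz₂ : z ∈ G₂) (hzℓ : z ∉ ℓ) : G₁ ⊆ G₂ := by
  have hzG : z ∈ G := hG₁.1 hz₁
  have hzcl : z ∉ M.closure ℓ := notMem_closure_of_gclosed hℓ hzG hzℓ
  have hins : M.eRk (insert z ℓ) = M.eRk ℓ + 1 := Matroid.eRk_insert_eq_add_one ⟨hG hzG, hzcl⟩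
  have hrℓ : (2 : ℕ∞) ≤ M.eRk ℓ := two_le_eRk_of_two_le_ncard_of_free M hfree (hℓ.1.trans hG) h2
  have hr3 : M.eRk G₁ ≤ M.eRk (insert z ℓ) := by
    rw [hins]
    calc M.eRk G₁ ≤ 3 := hr₁
      _ = 2 + 1 := by norm_num
      _ ≤ M.eRk ℓ + 1 := add_le_add hrℓ le_rfl
  have hG₁fin : G₁.Finite := (M.ground_finite.subset hG).subset hG₁.1
  have hcl : G₁ ⊆ M.closure (insert z ℓ) :=
    subset_closure_of_eRk_le M (Set.insert_subset hz₁ hℓ₁) (hG₁.1.trans hG) hG₁fin hr3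
  intro y hy
  exact hG₂.2 ⟨M.closure_subset_closure (Set.insert_subset hz₂ hℓ₂) (hcl hy), hG₁.1 hy⟩

/-- **(K3′) the covering pair of a non-prime `5`-point plane is unique**: if `H` (`5` points) is covered by the
`3`-point `G`-closed line `ℓ₁ ⊆ H` and a `G`-closed line `ℓ₂ ⊇ H ∖ ℓ₁`, then every cover of `H` by two `G`-closed
lines `A, B` is `(ℓ₁, ℓ₂)` or `(ℓ₂, ℓ₁)`. -/
theorem cover_pair_eq (M : Matroid α) [M.Finite]
    (hfree : ∀ e ∈ M.E, ∃ A ⊆ M.E \ {e}, e ∉ M.closure A ∧ e ∉ M.closure ((M.E \ {e}) \ A))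
    {G H ℓ₁ ℓ₂ A B : Set α} (hG : G ⊆ M.E) (hH : H ⊆ G) (h5 : H.ncard = 5)
    (hℓ₁ : GClosed M G ℓ₁) (hℓ₁H : ℓ₁ ⊆ H) (h3 : ℓ₁.ncard = 3) (hr₁ : M.eRk ℓ₁ ≤ 2)
    (hℓ₂ : GClosed M G ℓ₂) (hr₂ : M.eRk ℓ₂ ≤ 2) (hHℓ : H \ ℓ₁ ⊆ ℓ₂)
    (hA : GClosed M G A) (hB : GClosed M G B) (hrA : M.eRk A ≤ 2) (hrB : M.eRk B ≤ 2) (hcov : H ⊆ A ∪ B) :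
    (A = ℓ₁ ∧ B = ℓ₂) ∨ (A = ℓ₂ ∧ B = ℓ₁) := by
  have hGfin : G.Finite := M.ground_finite.subset hG
  have hHfin : H.Finite := hGfin.subset hH
  have hℓfin : ℓ₁.Finite := hHfin.subset hℓ₁H
  have hdiff : (H \ ℓ₁).ncard + ℓ₁.ncard = H.ncard := Set.ncard_sdiff_add_ncard_of_subset hℓ₁H hHfin
  -- pigeonhole on `ℓ₁ ⊆ A ∪ B`
  have hsplit : ℓ₁ ⊆ (ℓ₁ ∩ A) ∪ (ℓ₁ ∩ B) := by
    intro y hy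
    rcases hcov (hℓ₁H hy) with h | h
    · exact Or.inl ⟨hy, h⟩
    · exact Or.inr ⟨hy, h⟩
  have h3' : 3 ≤ (ℓ₁ ∩ A).ncard + (ℓ₁ ∩ B).ncard := by
    calc 3 = ℓ₁.ncard := h3.symm
      _ ≤ ((ℓ₁ ∩ A) ∪ (ℓ₁ ∩ B)).ncard := Set.ncard_le_ncard hsplit
          ((hℓfin.subset Set.inter_subset_left).union (hℓfin.subset Set.inter_subset_left))
      _ ≤ (ℓ₁ ∩ A).ncard + (ℓ₁ ∩ B).ncard := Set.ncard_union_le _ _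
  -- the side with two points of `ℓ₁` is `ℓ₁`; the other contains `H ∖ ℓ₁ ⊆ ℓ₂` (two points), so it is `ℓ₂`
  have key : ∀ C D : Set α, GClosed M G C → GClosed M G D → M.eRk C ≤ 2 → M.eRk D ≤ 2 → H ⊆ C ∪ D →
      2 ≤ (ℓ₁ ∩ C).ncard → C = ℓ₁ ∧ D = ℓ₂ := by
    intro C D hC hD hrC hrD hcovCD h2
    have hCℓ : C = ℓ₁ :=
      gclosed_eq_of_two_le_inter M hfree hG hC hℓ₁ hrC hr₁ (by rwa [Set.inter_comm])
    have hsub : H \ ℓ₁ ⊆ D := by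
      intro y hy
      rcases hcovCD hy.1 with h | h
      · exact absurd (show y ∈ ℓ₁ by rw [← hCℓ]; exact h) hy.2
      · exact h
    have h2' : 2 ≤ (D ∩ ℓ₂).ncard := by
      calc 2 = (H \ ℓ₁).ncard := by omega
        _ ≤ (D ∩ ℓ₂).ncard := Set.ncard_le_ncard (fun y hy => ⟨hsub hy, hHℓ hy⟩)
          ((hGfin.subset hD.1).subset Set.inter_subset_left)
    exact ⟨hCℓ, gclosed_eq_of_two_le_inter M hfree hG hD hℓ₂ hrD hr₂ h2'⟩
  rcases Nat.lt_or_ge (ℓ₁ ∩ A).ncard 2 with hlt | hge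
  · have hB2 : 2 ≤ (ℓ₁ ∩ B).ncard := by omega
    obtain ⟨h1, h2⟩ := key B A hB hA hrB hrA (by rw [Set.union_comm]; exact hcov) hB2
    exact Or.inr ⟨h2, h1⟩
  · exact Or.inl (key A B hA hB hrA hrB hcov hge)

end ThmN

end PercRepro
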